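import Literature.AlgebraicGeometry.ShimuraVarieties.UnitaryCurveSiegelBorelPieceFactor
import Literature.AlgebraicGeometry.Motives.BaseChangeTowerCofan
import HarnessLib

/-!
# The slice morphism OVER THE SLICE FIELD, read on a disc-quotient piece of the complex fibre: per-piece factorisation through the Siegel piece
# WITH THE SCHEME EQUATION against the descended morphism ([Deligne1971TravauxShimura] 4.11–4.12; [Milne2005ShimuraVarieties] Lemma 5.13, Thm. 5.16)

Topic `AlgebraicGeometry/ShimuraVarieties`; namespace `Literature.AlgebraicGeometry.ShimuraVarieties.UnitaryCanonicalModel` (the record-curve piece form of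
★ `UnitaryCurveSiegelBorelPieceFactor` §2–§3).  THEOREMS ONLY (no definition, no named fact, no instance, no notation, no `sorry`).  Cell `hodgecm-mathlib`
(D-0151), FLOOR 0, P6 «MOD» (crux hLiu418 = stmt-HodgeConjecture-24832, `--supports`), organ **(T1) SLICE∕PIECE** of the E6 closer of
`Cruxes/HLiu418/Lines/F0_P6a_PELWitnessE.lean` (socket Σ-AN `ReadsCReading`, E6 heir A-p06 (g33)): the `hk` premiss of ★ ASM (a)
`exists_isMonHom_conj_baseChange_baseChange_baseChange` and the `S.pts`-clause of `ReadsCReading`, for each piece of the complex fibre of the thickened record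
curve.  HC_CM is proved only modulo the printed citations (2 remaining named inputs hLiu418 24832, h413 24833) until rung 0 closes; generic, count-neutral.

## The mathematics
`S` a record system of `Sh(U(J⋆), 𝔻)` read through `ι₁ : F → ℂ`, `Kc` a small level, `Fᵢ ∕ F` a slice field with `τE : Fᵢ → ℂ` extending `ι₁`, `V₀` a smooth
quasi-projective `ℚ`-scheme (the Siegel fine moduli scheme) with a chart system `(Sc_c, ιc_c, unif_c)` on `V₀ ⊗_ℚ ℂ` whose legs form a coproduct, and a point map
`f : Sh_{Kc}(ℂ) → V₀(ℂ)` with holomorphic Siegel lifts `f [v, a Kc] = ιc_{piece a} (unif (Z_a v))` (the ★ `AuxChartGS` fields, BY VALUE).  Let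
`ε : (S.M Kc) ⊗_F Fᵢ ⟶ V₀ ⊗_ℚ Fᵢ` be an `Fᵢ`-morphism INDUCING `f` on complex points (`stub_E5`'s conclusion = `stub_E6`'s hypothesis `hε`), and let
`e : ((S.M Kc) ⊗_F Fᵢ) ⊗_{τE} ℂ ≅ (S.M Kc) ⊗_{ι₁} ℂ` be the tower isomorphism (★ COV-1 `exists_towerIso_isColimit_cofan_of_comp_eq`).  For a disc-quotient PIECE
`(X_q, B_q)` of `(S.M Kc) ⊗_{ι₁} ℂ` with leg `ι_q` and representative `a` (`ι_q (B_q.unif v) = [v, a Kc]`, the `pieces` clause of ★ `RecordSystemGS`):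
* §1 `algPoints_baseChangeHom_ext` (an `L`-point of `X ⊗_σ L` is determined by its projection to `X`), `baseChange_map_left_comp_fst`,
  **`map_towerSlice_eq`** — the complex morphism `e⁻¹ ≫ (ε ⊗ ℂ) ≫ e′ : (S.M Kc)_{ι₁} ⟶ V₀ ⊗_ℚ ℂ` (with `e′` the target tower iso) has the point formula of ★ E4:
  `Q ↦ f (pts Q)` read in `(V₀ ⊗ ℂ)(ℂ)`;
* §2 **`exists_pieceSlice_factor_comp_eq`** — there is `ψ_q : X_q ⟶ Sc_{piece a}` with `ψ_q (B_q.unif v) = unif (Z_a v)` on the negative cone (★ E6-fac) AND THE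
  SCHEME EQUATION `(ι_q ≫ e⁻¹) ≫ pr_X ≫ ε ≫ pr_{Fᵢ} = ψ_q ≫ ιc ≫ pr_ℚ : X_q → V₀` (★ `piece_factor_comp_eq_of_forall_map_eq`: complex points separate morphisms
  from the reduced `X_q` to the separated `V₀ ⊗ ℂ`) — the `hk` premiss of ★ ASM (a);
* §3 **`pts_eq_mk_of_piece_point`** — a complex point `x` of `(S.M Kc) ⊗_F Fᵢ` lying under the image of `B_q.unif v` along `ι_q ≫ e⁻¹` has flat shadow
  `pts x♭ = [v, a Kc]` (the `S.pts`-clause of `ReadsCReading`).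

## References
* [Deligne1971TravauxShimura] P. Deligne, *Travaux de Shimura*, Sém. Bourbaki 389 (1971), 4.11–4.12 p. 148.
* [Milne2005ShimuraVarieties] J. S. Milne, *Introduction to Shimura varieties* (2005; rev. 2017), Lemma 5.13 p. 57, Thm. 5.16, Prop. 13.1 p. 117.
* [GortzWedhorn2020] U. Görtz, T. Wedhorn, *Algebraic Geometry I* (2nd ed. 2020), (4.7) base change and points (p. 108).
-/

set_option autoImplicit false

noncomputable section

open Function Topology NumberField CategoryTheory CategoryTheory.Limits Matrix AlgebraicGeometry Set
open scoped Matrix ComplexOrder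
open Literature.AlgebraicGeometry.Motives Literature.AlgebraicGeometry.Motives.AlgPoints
open Literature.AlgebraicGeometry.Motives.AbelianVariety (bcSpec)
open Literature.AlgebraicGeometry.HodgeTheory (IsQuasiProjectiveOver)
open Literature.NumberTheory.Automorphic (siegelUpperHalfSpace)
open Literature.NumberTheory.Automorphic.UnitaryGroup
open Literature.NumberTheory.Automorphic.Liu2021.AppendixC (C5.OpenCompactSubgroup C5.SmallLevel)

namespace Literature.AlgebraicGeometry.ShimuraVarieties.UnitaryCanonicalModel

/-! ### §1. Points of a base change; the complex slice morphism along the towers has the point formula of ★ E4 -/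

/-- An `L`-point of `X ⊗_σ L` over `L` is determined by its projection to `X` ([GortzWedhorn2020] (4.7): `Hom_L(Spec L, X ⊗_σ L) = Hom_k(Spec L, X)`,
★ `AlgPoints.baseChangeEquiv`). [cite: GortzWedhorn2020, Section (4.7) p. 108] -/
theorem algPoints_baseChangeHom_ext {k L : Type} [Field k] [Field L] (σ : k →+* L) (X : SchemeOver k)
    (R₁ R₂ : AlgPoints ((baseChangeHom σ).obj X) L) (h : R₁.left ≫ baseChangeHomFst σ X = R₂.left ≫ baseChangeHomFst σ X) : R₁ = R₂ := by
  apply (AlgPoints.baseChangeEquiv σ X).symm.injective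
  letI := σ.toAlgebra
  apply Over.OverMorphism.ext
  rw [AlgPoints.baseChangeEquiv_symm_apply_left, AlgPoints.baseChangeEquiv_symm_apply_left, h]

/-- The base change of a morphism commutes with the first projections: `(φ ⊗ L) ≫ pr = pr ≫ φ` on underlying schemes. [folklore] [cite: GortzWedhorn2020, Section (4.7) p. 108] -/
theorem baseChange_map_left_comp_fst {K L : Type} [Field K] [Field L] [Algebra K L] {X Y : SchemeOver K} (φ : X ⟶ Y) :
    ((baseChange K L).map φ).left ≫ pullback.fst Y.hom (bcSpec K L) = pullback.fst X.hom (bcSpec K L) ≫ φ.left := by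
  change ((Over.pullback (bcSpec K L)).map φ).left ≫ _ = _
  simp only [Over.pullback_map_left]
  erw [pullback.lift_fst]

section Slice

variable {L : Type} [Field L] [NumberField L] [IsCMField L] {Jstar : Matrix (Fin 2) (Fin 2) L} {τ : L →+* ℂ}
  {K₀ : C5.OpenCompactSubgroup ↥(finAdelic (↥(maximalRealSubfield L)) L (IsCMField.complexConj L) 2 Jstar)}
  (S : RecordSystemGS L Jstar τ K₀) (K : C5.SmallLevel K₀)
  {Fi : Type} [Field Fi] [NumberField Fi] [Algebra L Fi] (τE : Fi →+* ℂ) (hτE : τE.comp (algebraMap L Fi) = τ)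
  {g : ℕ} {κ : Type} (V₀ : SchemeOver ℚ) [Smooth V₀.hom] (hV₀ : IsQuasiProjectiveOver V₀)
  (Sc : κ → SchemeOver ℂ) (ιc : ∀ c, Sc c ⟶ (Motives.baseChange ℚ ℂ).obj V₀) (hcol : IsColimit (Cofan.mk ((Motives.baseChange ℚ ℂ).obj V₀) ιc))
  (unif : ∀ c : κ, Matrix (Fin g) (Fin g) ℂ → ComplexPoints (Sc c))
  (unif_cont : ∀ c, ContinuousOn (unif c) (siegelUpperHalfSpace g))
  (unif_hol : ∀ (c : κ) (U : (Sc c).left.affineOpens) (s : (Sc c).left.presheaf.obj (Opposite.op (↑U : (Sc c).left.Opens))),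
    DifferentiableOn ℂ (fun Z ↦ AlgPoints.evalOrZero (↑U : (Sc c).left.Opens) s (unif c Z))
      (siegelUpperHalfSpace g ∩ unif c ⁻¹' {P | P.pt ∈ (↑U : (Sc c).left.Opens)}))
  (f : ShimuraSetGS L Jstar τ K.1.1 → ComplexPoints V₀)
  (piece : ↥(finAdelic (↥(maximalRealSubfield L)) L (IsCMField.complexConj L) 2 Jstar) → κ)
  (Z : ↥(finAdelic (↥(maximalRealSubfield L)) L (IsCMField.complexConj L) 2 Jstar) → (Fin 2 → ℂ) → Matrix (Fin g) (Fin g) ℂ)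
  (Z_hol : ∀ (a : ↥(finAdelic (↥(maximalRealSubfield L)) L (IsCMField.complexConj L) 2 Jstar)) (i j : Fin g),
    DifferentiableOn ℂ (fun v => Z a v i j) (negCone (Jstar.map τ)))
  (Z_mem : ∀ (a : ↥(finAdelic (↥(maximalRealSubfield L)) L (IsCMField.complexConj L) 2 Jstar)) (v : Fin 2 → ℂ),
    v ∈ negCone (Jstar.map τ) → Z a v ∈ siegelUpperHalfSpace g)
  (f_mk : ∀ (v : Fin 2 → ℂ) (hv : v ∈ negCone (Jstar.map τ))
      (a : ↥(finAdelic (↥(maximalRealSubfield L)) L (IsCMField.complexConj L) 2 Jstar)),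
    f (ShimuraSetGS.mk L Jstar τ K.1.1 v hv a) =
      (AlgPoints.baseChangeEquiv (algebraMap ℚ ℂ) V₀).symm (AlgPoints.map (ιc (piece a)) (unif (piece a) (Z a v))))
  -- the slice morphism over `Fᵢ` inducing `f` on complex points (`stub_E5`'s conclusion, `stub_E6`'s hypothesis `hε`, BY VALUE)
  (ε : (Motives.baseChange L Fi).obj (S.M.obj K) ⟶ (Motives.baseChange ℚ Fi).obj V₀)
  (hε : letI : Algebra Fi ℂ := τE.toAlgebra
    ∀ (P : ComplexPoints ((Motives.baseChange L Fi).obj (S.M.obj K)))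
      (Pflat : letI : Algebra L ℂ := τ.toAlgebra; ComplexPoints (S.M.obj K)),
      Pflat.left = P.left ≫ pullback.fst (S.M.obj K).hom (bcSpec L Fi) →
      (AlgPoints.map ε P).left ≫ pullback.fst V₀.hom (bcSpec ℚ Fi) =
        (letI : Algebra L ℂ := τ.toAlgebra; (f (S.pts K Pflat)).left))
  -- the source tower isomorphism (★ COV-1), BY VALUE with its projection law
  (e : letI : Algebra Fi ℂ := τE.toAlgebra
    (Motives.baseChange Fi ℂ).obj ((Motives.baseChange L Fi).obj (S.M.obj K)) ≅ (Motives.baseChangeHom τ).obj (S.M.obj K))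
  (he : letI : Algebra Fi ℂ := τE.toAlgebra
    e.inv.left ≫ pullback.fst ((Motives.baseChange L Fi).obj (S.M.obj K)).hom (bcSpec Fi ℂ) ≫ pullback.fst (S.M.obj K).hom (bcSpec L Fi) =
      pullback.fst (S.M.obj K).hom (Spec.map (CommRingCat.ofHom τ)))

/-- `τE` restricted to `ℚ` is THE embedding `ℚ → ℂ`. [folklore] [cite: GortzWedhorn2020, Section (4.7) p. 108] -/
private theorem comp_algebraMap_rat_eq : τE.comp (algebraMap ℚ Fi) = algebraMap ℚ ℂ := Subsingleton.elim _ _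

omit [Smooth V₀.hom] in
include hε he in
/-- **The complex slice morphism along the towers has the point formula of ★ E4.**  For the target tower isomorphism `e′ : (V₀ ⊗_ℚ Fᵢ) ⊗_{τE} ℂ ≅ V₀ ⊗_ℚ ℂ` with
`e′ ≫ pr_ℚ = pr_{Fᵢ,ℂ} ≫ pr_{ℚ,Fᵢ}`, the morphism `e⁻¹ ≫ (ε ⊗ ℂ) ≫ e′ : (S.M K)_τ ⟶ V₀ ⊗_ℚ ℂ` sends the complex point `Q` (moved from `S.M K` by
`AlgPoints.baseChangeEquiv τ`) to `f (pts Q)` read in `(V₀ ⊗ ℂ)(ℂ)` — because `ε` induces `f` (`hε`) and all the projections commute.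
[cite: Milne2005ShimuraVarieties, Prop. 13.1 p. 117] [cite: GortzWedhorn2020, Section (4.7) p. 108] -/
theorem map_towerSlice_eq
    (e' : letI : Algebra Fi ℂ := τE.toAlgebra
      (Motives.baseChange Fi ℂ).obj ((Motives.baseChange ℚ Fi).obj V₀) ≅ (Motives.baseChangeHom (algebraMap ℚ ℂ)).obj V₀)
    (he' : letI : Algebra Fi ℂ := τE.toAlgebra
      e'.hom.left ≫ pullback.fst V₀.hom (Spec.map (CommRingCat.ofHom (algebraMap ℚ ℂ))) =
        pullback.fst ((Motives.baseChange ℚ Fi).obj V₀).hom (bcSpec Fi ℂ) ≫ pullback.fst V₀.hom (bcSpec ℚ Fi))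
    (Q : ComplexPoints ((Motives.baseChangeHom τ).obj (S.M.obj K))) :
    letI : Algebra Fi ℂ := τE.toAlgebra
    letI : Algebra L ℂ := τ.toAlgebra
    AlgPoints.map (e.inv ≫ (Motives.baseChange Fi ℂ).map ε ≫ e'.hom) Q =
      AlgPoints.baseChangeEquiv (algebraMap ℚ ℂ) V₀ (f (S.pts K ((AlgPoints.baseChangeEquiv τ (S.M.obj K)).symm Q))) := by
  letI : Algebra Fi ℂ := τE.toAlgebra
  letI : Algebra L ℂ := τ.toAlgebra
  -- clean-typed aliases for the projections (one spelling per object)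
  let fst₁ : ((Motives.baseChange Fi ℂ).obj ((Motives.baseChange L Fi).obj (S.M.obj K))).left ⟶ ((Motives.baseChange L Fi).obj (S.M.obj K)).left :=
    pullback.fst ((Motives.baseChange L Fi).obj (S.M.obj K)).hom (bcSpec Fi ℂ)
  let fst₂ : ((Motives.baseChange L Fi).obj (S.M.obj K)).left ⟶ (S.M.obj K).left := pullback.fst (S.M.obj K).hom (bcSpec L Fi)
  let fstτ : ((Motives.baseChangeHom τ).obj (S.M.obj K)).left ⟶ (S.M.obj K).left := pullback.fst (S.M.obj K).hom (Spec.map (CommRingCat.ofHom τ))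
  let fsta : ((Motives.baseChange Fi ℂ).obj ((Motives.baseChange ℚ Fi).obj V₀)).left ⟶ ((Motives.baseChange ℚ Fi).obj V₀).left :=
    pullback.fst ((Motives.baseChange ℚ Fi).obj V₀).hom (bcSpec Fi ℂ)
  let fstb : ((Motives.baseChange ℚ Fi).obj V₀).left ⟶ V₀.left := pullback.fst V₀.hom (bcSpec ℚ Fi)
  let fstℚ : ((Motives.baseChangeHom (algebraMap ℚ ℂ)).obj V₀).left ⟶ V₀.left := pullback.fst V₀.hom (Spec.map (CommRingCat.ofHom (algebraMap ℚ ℂ)))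
  let bcε : ((Motives.baseChange Fi ℂ).obj ((Motives.baseChange L Fi).obj (S.M.obj K))).left ⟶
      ((Motives.baseChange Fi ℂ).obj ((Motives.baseChange ℚ Fi).obj V₀)).left := ((Motives.baseChange Fi ℂ).map ε).left
  have he₁ : e.inv.left ≫ fst₁ ≫ fst₂ = fstτ := he
  have he'₁ : e'.hom.left ≫ fstℚ = fsta ≫ fstb := he'
  have hbc : bcε ≫ fsta = fst₁ ≫ ε.left := baseChange_map_left_comp_fst ε
  -- the complex point of the thickened curve under `Q`, read as an `Fᵢ → ℂ` point `P`, and its flat shadow `P♭`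
  let Pc : ComplexPoints ((Motives.baseChange Fi ℂ).obj ((Motives.baseChange L Fi).obj (S.M.obj K))) := AlgPoints.map e.inv Q
  let P : ComplexPoints ((Motives.baseChange L Fi).obj (S.M.obj K)) :=
    (AlgPoints.baseChangeEquiv τE ((Motives.baseChange L Fi).obj (S.M.obj K))).symm Pc
  let Pflat : ComplexPoints (S.M.obj K) := (AlgPoints.baseChangeEquiv τ (S.M.obj K)).symm Q
  have hPc : Pc.left = Q.left ≫ e.inv.left := rfl
  have hP : P.left = Pc.left ≫ fst₁ := AlgPoints.baseChangeEquiv_symm_apply_left τE _ Pc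
  have hQ : Pflat.left = Q.left ≫ fstτ := AlgPoints.baseChangeEquiv_symm_apply_left τ _ Q
  have hPflat : Pflat.left = P.left ≫ pullback.fst (S.M.obj K).hom (bcSpec L Fi) := by
    change Pflat.left = P.left ≫ fst₂
    rw [hQ, hP, hPc, ← he₁]
    exact ((Category.assoc _ _ _).trans (Category.assoc _ _ _)).symm
  have hεP : (P.left ≫ ε.left) ≫ fstb = (f (S.pts K Pflat)).left := hε P Pflat hPflat
  -- compare the two complex points of `V₀ ⊗ ℂ` through their projections to `V₀`
  apply algPoints_baseChangeHom_ext (algebraMap ℚ ℂ) V₀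
  have hR : (AlgPoints.baseChangeEquiv (algebraMap ℚ ℂ) V₀ (f (S.pts K Pflat))).left ≫ baseChangeHomFst (algebraMap ℚ ℂ) V₀ =
      (f (S.pts K Pflat)).left := AlgPoints.baseChangeEquiv_apply_left_comp_fst (algebraMap ℚ ℂ) V₀ _
  rw [hR, ← hεP, hP, hPc]
  change (Q.left ≫ e.inv.left ≫ bcε ≫ e'.hom.left) ≫ fstℚ = (((Q.left ≫ e.inv.left) ≫ fst₁) ≫ ε.left) ≫ fstb
  simp only [Category.assoc]
  rw [he'₁, reassoc_of% hbc]

include hV₀ hcol unif_cont unif_hol Z_hol Z_mem f_mk hε he in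
/-- **(T1) PER-PIECE FACTORISATION OF THE SLICE MORPHISM WITH THE SCHEME EQUATION.**  For a disc-quotient piece `(X_q, B_q)` of `(S.M K)_τ` with leg `ι_q` and
adelic representative `a` (`ι_q (B_q.unif v) = [v, aK]` — the `pieces` clause of ★ `RecordSystemGS`), there is `ψ_q : X_q ⟶ Sc_{piece a}` with
`ψ_q (B_q.unif v) = unif (Z_a v)` on the negative cone (★ E6-fac `exists_hom_piece_factor_of_holomorphicSiegelLift` against the point map `Q ↦ f (pts Q)`) AND
`(ι_q ≫ e⁻¹) ≫ pr ≫ ε ≫ pr_{ℚ,Fᵢ} = ψ_q ≫ ιc_{piece a} ≫ pr_ℚ` as morphisms `X_q → V₀` (★ `piece_factor_comp_eq_of_forall_map_eq` with §1 `map_towerSlice_eq`, and the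
projection laws of the two towers) — the `hk` premiss of ★ ASM (a) `exists_isMonHom_conj_baseChange_baseChange_baseChange` for the leg of the piece.
[cite: Deligne1971TravauxShimura, 4.11–4.12 p. 148] [cite: Milne2005ShimuraVarieties, Lemma 5.13 p. 57 and Thm. 5.16] -/
theorem exists_pieceSlice_factor_comp_eq (Xq : SchemeOver ℂ) (Bq : UnitaryBallUniformisationDatum 1 Xq) (hB : Bq.Hℂ = Jstar.map τ)
    (ιq : Xq ⟶ (Motives.baseChangeHom τ).obj (S.M.obj K)) (a : ↥(finAdelic (↥(maximalRealSubfield L)) L (IsCMField.complexConj L) 2 Jstar))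
    (hιq : letI : Algebra L ℂ := τ.toAlgebra
      ∀ (v : Fin 2 → ℂ) (hv : v ∈ negCone (Jstar.map τ)),
        AlgPoints.map ιq (Bq.unif v) = AlgPoints.baseChangeEquiv τ (S.M.obj K) ((S.pts K).symm (ShimuraSetGS.mk L Jstar τ K.1.1 v hv a))) :
    letI : Algebra Fi ℂ := τE.toAlgebra
    ∃ ψq : Xq ⟶ Sc (piece a),
      (∀ v, v ∈ negCone (Jstar.map τ) → AlgPoints.map ψq (Bq.unif v) = unif (piece a) (Z a v)) ∧
      (ιq ≫ e.inv).left ≫ pullback.fst ((Motives.baseChange L Fi).obj (S.M.obj K)).hom (bcSpec Fi ℂ) ≫ ε.left ≫ pullback.fst V₀.hom (bcSpec ℚ Fi) =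
        ψq.left ≫ (ιc (piece a)).left ≫ pullback.fst V₀.hom (Spec.map (CommRingCat.ofHom (algebraMap ℚ ℂ))) := by
  letI : Algebra Fi ℂ := τE.toAlgebra
  letI : Algebra L ℂ := τ.toAlgebra
  -- the target over `ℂ`: smooth (base change) and quasi-projective
  haveI : Smooth ((Motives.baseChange ℚ ℂ).obj V₀).hom := MorphismProperty.pullback_snd (P := @Smooth) _ _ ‹Smooth V₀.hom›
  have hVq : IsQuasiProjectiveOver ((Motives.baseChange ℚ ℂ).obj V₀) :=
    Literature.AlgebraicGeometry.HodgeTheory.IsQuasiProjectiveOver.baseChangeHom (algebraMap ℚ ℂ) hV₀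
  -- the target tower isomorphism (★ COV-1)
  obtain ⟨e', he', -⟩ := Motives.exists_towerIso_of_comp_eq τE (algebraMap ℚ ℂ) (comp_algebraMap_rat_eq τE) V₀
  -- the point map of ★ E4 and the complex slice morphism along the towers
  let Φ : ComplexPoints ((Motives.baseChangeHom τ).obj (S.M.obj K)) → ComplexPoints ((Motives.baseChange ℚ ℂ).obj V₀) := fun Q =>
    AlgPoints.baseChangeEquiv (algebraMap ℚ ℂ) V₀ (f (S.pts K ((AlgPoints.baseChangeEquiv τ (S.M.obj K)).symm Q)))
  let u : (Motives.baseChangeHom τ).obj (S.M.obj K) ⟶ (Motives.baseChange ℚ ℂ).obj V₀ := e.inv ≫ (Motives.baseChange Fi ℂ).map ε ≫ e'.hom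
  have hu : ∀ Q, AlgPoints.map u Q = Φ Q := fun Q =>
    map_towerSlice_eq S K τE V₀ f ε hε e he e' he' Q
  -- ★ E6-fac on the piece
  obtain ⟨ψq, h1, h2⟩ := exists_hom_piece_factor_of_holomorphicSiegelLift ((Motives.baseChange ℚ ℂ).obj V₀) hVq Sc ιc hcol unif unif_cont
    unif_hol Bq hB ιq Φ (piece a) (Z a) (Z_hol a) (Z_mem a) (fun v hv => by
      change AlgPoints.baseChangeEquiv (algebraMap ℚ ℂ) V₀
          (f (S.pts K ((AlgPoints.baseChangeEquiv τ (S.M.obj K)).symm (AlgPoints.map ιq (Bq.unif v))))) = _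
      rw [hιq v hv, Equiv.symm_apply_apply, Homeomorph.apply_symm_apply, f_mk v hv a, Equiv.apply_symm_apply]
      rfl)
  refine ⟨ψq, h1, ?_⟩
  -- ★ points separate: `ψq ≫ ιc = ιq ≫ u`
  have hfac : ψq ≫ ιc (piece a) = ιq ≫ u :=
    piece_factor_comp_eq_of_forall_map_eq ((Motives.baseChange ℚ ℂ).obj V₀) hVq Sc ιc Bq ιq Φ (piece a) ψq (ιq ≫ u) h2 (fun P => by
      rw [AlgPoints.map_comp_apply, hu])
  -- read the scheme equation off `hfac` through the projections of the two towers (clean-typed aliases, one spelling per object)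
  let fst₁ : ((Motives.baseChange Fi ℂ).obj ((Motives.baseChange L Fi).obj (S.M.obj K))).left ⟶ ((Motives.baseChange L Fi).obj (S.M.obj K)).left :=
    pullback.fst ((Motives.baseChange L Fi).obj (S.M.obj K)).hom (bcSpec Fi ℂ)
  let fsta : ((Motives.baseChange Fi ℂ).obj ((Motives.baseChange ℚ Fi).obj V₀)).left ⟶ ((Motives.baseChange ℚ Fi).obj V₀).left :=
    pullback.fst ((Motives.baseChange ℚ Fi).obj V₀).hom (bcSpec Fi ℂ)
  let fstb : ((Motives.baseChange ℚ Fi).obj V₀).left ⟶ V₀.left := pullback.fst V₀.hom (bcSpec ℚ Fi)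
  let fstℚ : ((Motives.baseChange ℚ ℂ).obj V₀).left ⟶ V₀.left := pullback.fst V₀.hom (Spec.map (CommRingCat.ofHom (algebraMap ℚ ℂ)))
  let bcε : ((Motives.baseChange Fi ℂ).obj ((Motives.baseChange L Fi).obj (S.M.obj K))).left ⟶
      ((Motives.baseChange Fi ℂ).obj ((Motives.baseChange ℚ Fi).obj V₀)).left := ((Motives.baseChange Fi ℂ).map ε).left
  let e'h : ((Motives.baseChange Fi ℂ).obj ((Motives.baseChange ℚ Fi).obj V₀)).left ⟶ ((Motives.baseChange ℚ ℂ).obj V₀).left := e'.hom.left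
  have he'₁ : e'h ≫ fstℚ = fsta ≫ fstb := he'
  have hbc : bcε ≫ fsta = fst₁ ≫ ε.left := baseChange_map_left_comp_fst ε
  have hl : ψq.left ≫ (ιc (piece a)).left = ιq.left ≫ e.inv.left ≫ bcε ≫ e'h := by
    have := congrArg CommaMorphism.left hfac
    simp only [Over.comp_left] at this
    exact this
  change ((ιq.left ≫ e.inv.left) ≫ fst₁) ≫ ε.left ≫ fstb = ψq.left ≫ (ιc (piece a)).left ≫ fstℚ
  rw [← Category.assoc ψq.left, hl]
  simp only [Category.assoc]
  rw [he'₁, reassoc_of% hbc]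

omit [NumberField Fi] in
include he in
/-- **(T1′) THE FLAT SHADOW OF A POINT UNDER A PIECE.**  If a complex point `x` of `(S.M K) ⊗_L Fᵢ` (along `τE`) lies under `B_q.unif v` along the leg `ι_q ≫ e⁻¹`
(`x = (B_q.unif v) ≫ ι_q ≫ e⁻¹ ≫ pr`), then its flat shadow `x♭` (`x♭.left = x.left ≫ pr_{L,Fᵢ}`) has `pts x♭ = [v, aK]` — the `S.pts`-clause of the E6 closer's
`ReadsCReading` on the piece. [cite: Milne2005ShimuraVarieties, Lemma 5.13 p. 57] [cite: Deligne1979ShimuraVarieties, 2.1.2] -/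
theorem pts_eq_mk_of_piece_point (Xq : SchemeOver ℂ) (Bq : UnitaryBallUniformisationDatum 1 Xq)
    (ιq : Xq ⟶ (Motives.baseChangeHom τ).obj (S.M.obj K)) (a : ↥(finAdelic (↥(maximalRealSubfield L)) L (IsCMField.complexConj L) 2 Jstar))
    (hιq : letI : Algebra L ℂ := τ.toAlgebra
      ∀ (v : Fin 2 → ℂ) (hv : v ∈ negCone (Jstar.map τ)),
        AlgPoints.map ιq (Bq.unif v) = AlgPoints.baseChangeEquiv τ (S.M.obj K) ((S.pts K).symm (ShimuraSetGS.mk L Jstar τ K.1.1 v hv a)))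
    (v : Fin 2 → ℂ) (hv : v ∈ negCone (Jstar.map τ))
    (x : letI : Algebra Fi ℂ := τE.toAlgebra; ComplexPoints ((Motives.baseChange L Fi).obj (S.M.obj K)))
    (Pflat : letI : Algebra L ℂ := τ.toAlgebra; ComplexPoints (S.M.obj K))
    (hPflat : Pflat.left = x.left ≫ pullback.fst (S.M.obj K).hom (bcSpec L Fi))
    (hx : letI : Algebra Fi ℂ := τE.toAlgebra
      x.left = (Bq.unif v).left ≫ (ιq ≫ e.inv).left ≫ pullback.fst ((Motives.baseChange L Fi).obj (S.M.obj K)).hom (bcSpec Fi ℂ)) :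
    letI : Algebra L ℂ := τ.toAlgebra
    S.pts K Pflat = ShimuraSetGS.mk L Jstar τ K.1.1 v hv a := by
  letI : Algebra Fi ℂ := τE.toAlgebra
  letI : Algebra L ℂ := τ.toAlgebra
  have h1 : (AlgPoints.map ιq (Bq.unif v)).left ≫ baseChangeHomFst τ (S.M.obj K) =
      ((S.pts K).symm (ShimuraSetGS.mk L Jstar τ K.1.1 v hv a)).left := by
    rw [hιq v hv]
    exact AlgPoints.baseChangeEquiv_apply_left_comp_fst τ _ _
  have h2 : Pflat = (S.pts K).symm (ShimuraSetGS.mk L Jstar τ K.1.1 v hv a) := by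
    apply Over.OverMorphism.ext
    rw [← h1, hPflat, hx]
    change ((Bq.unif v).left ≫ (ιq.left ≫ e.inv.left) ≫ _) ≫ _ =
      ((Bq.unif v).left ≫ ιq.left) ≫ pullback.fst (S.M.obj K).hom (Spec.map (CommRingCat.ofHom τ))
    simp only [Category.assoc]
    rw [he]
  rw [h2, Homeomorph.apply_symm_apply]

end Slice

end Literature.AlgebraicGeometry.ShimuraVarieties.UnitaryCanonicalModel

end
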